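import Mathlib
import HarnessLib
import Literature.Computability.AlgebraicComplexity.AsymptoticSpectrum
import Literature.Computability.AlgebraicComplexity.BorderRankCW
import Literature.Computability.AlgebraicComplexity.MatMulPolystableProofs
import Literature.Computability.AlgebraicComplexity.DegenerationSpectralMonotone
import Literature.Barriers.MatrixMultiplication.RectangularBarrier
import Summits.MatrixMultiplication.MatrixMultiplication.Theorems.OutsiderSandwichPolystableRigidity
import Summits.MatrixMultiplication.MatrixMultiplication.Theorems.OutsiderSandwichCwTwoPowPolystable

/-!
# OutsiderSandwich — Kempf–Ness rigidity for the exchange rungs `⟨n'⟩ ⊠ ⟨m,m,m⟩` vs `⟨n⟩ ⊠ cw₂^{⊠N}`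
(lens-4 g32; critic g14 ask s2: price the level-one question of the first open rung `1/2`)

Route-independent support kernel (no `Theses` import).  The g31 exchange ladder reads rung `p/q` as the
asymptotic restriction `⟨3^q⟩ ⊠ ⟨2^p,2^p,2^p⟩ ≲ ⟨4^p⟩ ⊠ cw₂^{⊠q}`; both sides have the SAME cubic format
`3^q 4^p`, and both are Kronecker products of a unit tensor with a critical concise tensor.  This file
proves:

* `isPolystableTensor_of_gram` — packaging of `isClosed_tripleOrbit_of_gram` (scalar Gram matrices on
  the three legs + conciseness ⟹ closed `SL³`-orbit);
* Gram matrices and conciseness are multiplicative under `kroneckerTensor` with a unit tensor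
  (`gram_kronecker_fst/snd/thd`, `gram_unitTensor_fst/snd/thd`, `concise_unitKronecker_fst/snd/thd`), hence
  `isPolystableTensor_unitKronecker_cwTwoPow n N : IsPolystableTensor (⟨n⟩ ⊠ cw₂^{⊠N})` and
  `isPolystableTensor_unitKronecker_matMul n m : IsPolystableTensor (⟨n⟩ ⊠ ⟨m,m,m⟩)`;
* **rigidity of every rung at level one** (`unitKronecker_restricts_both_of_degeneratesTo`): for ANY
  bijection `e` of the two formats, a DEGENERATION (orbit-closure sense) `⟨n⟩ ⊠ cw₂^{⊠N} ⊵ e^*(⟨n'⟩ ⊠ ⟨m,m,m⟩)`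
  (`n', m ≥ 1`) is a two-sided restriction — indeed an isomorphism up to a scalar
  (`OutsiderSandwichPolystableRigidity.exists_smul_sl3_eq_of_degeneratesTo`);
* its spectral shadow (`spectral_eq_of_restricts_both`): a two-sided restriction puts EVERY universal
  spectral point on the rung line, `n' · F⟨m,m,m⟩ = n · F(cw₂)^N`; for the rung `1/2`
  (`n = 4, N = 2, n' = 9, m = 2`, formats `36`): `9 F⟨2,2,2⟩ = 4 F(cw₂)²` for all universal `F`
  (`rungHalf_levelOne`).

What this prices (memo NODE-g32 §3): the level-one degeneration `⟨4⟩ ⊠ cw₂^{⊠2} ⊵ ⟨9⟩ ⊠ ⟨2,2,2⟩` would be an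
ISOMORPHISM of `36 × 36 × 36` tensors; `⊕⁹⟨2,2,2⟩` has a slice of rank `2` while every non-zero slice of
`⊕⁴ cw₂^{⊠2}` has rank `≥ 4` (hand proof in the memo) — so the first open rung has NO level-one witness,
although no known universal spectral point separates the two sides (`9·4 = 4·9` at every quantum functional).
Rung 0 on `ω`.

References: [cite: KempfNess1979, Thm. 0.2]; [cite: BurgisserIkenmeyer2017, §4.2, Cor. 4.9];
[cite: Strassen1988, Thm. 3.8]; [cite: CoppersmithWinograd1990, §6].
-/

noncomputable section

open scoped BigOperators

open Literature.Computability.AlgebraicComplexity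

namespace Summit.MatrixMultiplication.MatrixMultiplication.Theorems.OutsiderSandwichUnitKroneckerRigidity

open OutsiderSandwichPolystableRigidity OutsiderSandwichCwTwoPowPolystable

/-! ## §1  Packaging: scalar Gram matrices + conciseness ⟹ polystable -/

section Packaging

variable {ρ : Type} [Fintype ρ] [DecidableEq ρ]

/-- **Critical + concise ⟹ polystable** (Kempf–Ness via Bürgisser–Ikenmeyer), packaged on
`IsPolystableTensor`. [cite: KempfNess1979, Thm. 0.2; BurgisserIkenmeyer2017, §4.2] -/
theorem isPolystableTensor_of_gram (w : ρ → ρ → ρ → ℂ) {cst : ℂ}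
    (hG1 : ∀ a a' : ρ, ∑ b, ∑ c, (starRingEnd ℂ) (w a' b c) * w a b c = if a = a' then cst else 0)
    (hG2 : ∀ b b' : ρ, ∑ a, ∑ c, (starRingEnd ℂ) (w a b' c) * w a b c = if b = b' then cst else 0)
    (hG3 : ∀ c c' : ρ, ∑ a, ∑ b, (starRingEnd ℂ) (w a b c') * w a b c = if c = c' then cst else 0)
    (h1 : ∀ v : ρ → ℂ, (∀ b c, ∑ a, v a * w a b c = 0) → v = 0)
    (h2 : ∀ v : ρ → ℂ, (∀ a c, ∑ b, v b * w a b c = 0) → v = 0)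
    (h3 : ∀ v : ρ → ℂ, (∀ a b, ∑ c, v c * w a b c = 0) → v = 0) : IsPolystableTensor w := by
  have h := isClosed_tripleOrbit_of_gram w hG1 hG2 hG3 h1 h2 h3
  unfold IsPolystableTensor
  convert h using 1
  ext s
  simp only [Set.mem_range, Set.mem_setOf_eq, Prod.exists]
  constructor
  · rintro ⟨A, B, C, rfl⟩
    exact ⟨A, B, C, A.2, B.2, C.2, rfl⟩
  · rintro ⟨A, B, C, hA, hB, hC, rfl⟩
    exact ⟨⟨A, hA⟩, ⟨B, hB⟩, ⟨C, hC⟩, rfl⟩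

end Packaging

/-! ## §2  Gram matrices and conciseness of Kronecker products with a unit tensor -/

section Kronecker

variable {σ τ : Type} [Fintype σ] [DecidableEq σ] [Fintype τ] [DecidableEq τ]

omit [DecidableEq σ] [DecidableEq τ] in
/-- First Gram matrix of a Kronecker product = product of the first Gram matrices. [folklore] -/
theorem gram_kronecker_fst (s : σ → σ → σ → ℂ) (t : τ → τ → τ → ℂ) (A A' : σ × τ) :
    ∑ B : σ × τ, ∑ C : σ × τ,
        (starRingEnd ℂ) (kroneckerTensor s t A' B C) * kroneckerTensor s t A B C =
      (∑ b, ∑ c, (starRingEnd ℂ) (s A'.1 b c) * s A.1 b c) *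
        (∑ y, ∑ z, (starRingEnd ℂ) (t A'.2 y z) * t A.2 y z) := by
  rw [Finset.sum_mul_sum, Fintype.sum_prod_type]
  refine Finset.sum_congr rfl fun b _ => Finset.sum_congr rfl fun y _ => ?_
  rw [Finset.sum_mul_sum, Fintype.sum_prod_type]
  refine Finset.sum_congr rfl fun c _ => Finset.sum_congr rfl fun z _ => ?_
  simp only [kroneckerTensor, map_mul]
  ring

omit [DecidableEq σ] [DecidableEq τ] in
/-- Second Gram matrix of a Kronecker product. [folklore] -/
theorem gram_kronecker_snd (s : σ → σ → σ → ℂ) (t : τ → τ → τ → ℂ) (B B' : σ × τ) :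
    ∑ A : σ × τ, ∑ C : σ × τ,
        (starRingEnd ℂ) (kroneckerTensor s t A B' C) * kroneckerTensor s t A B C =
      (∑ a, ∑ c, (starRingEnd ℂ) (s a B'.1 c) * s a B.1 c) *
        (∑ x, ∑ z, (starRingEnd ℂ) (t x B'.2 z) * t x B.2 z) := by
  rw [Finset.sum_mul_sum, Fintype.sum_prod_type]
  refine Finset.sum_congr rfl fun a _ => Finset.sum_congr rfl fun x _ => ?_
  rw [Finset.sum_mul_sum, Fintype.sum_prod_type]
  refine Finset.sum_congr rfl fun c _ => Finset.sum_congr rfl fun z _ => ?_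
  simp only [kroneckerTensor, map_mul]
  ring

omit [DecidableEq σ] [DecidableEq τ] in
/-- Third Gram matrix of a Kronecker product. [folklore] -/
theorem gram_kronecker_thd (s : σ → σ → σ → ℂ) (t : τ → τ → τ → ℂ) (C C' : σ × τ) :
    ∑ A : σ × τ, ∑ B : σ × τ,
        (starRingEnd ℂ) (kroneckerTensor s t A B C') * kroneckerTensor s t A B C =
      (∑ a, ∑ b, (starRingEnd ℂ) (s a b C'.1) * s a b C.1) *
        (∑ x, ∑ y, (starRingEnd ℂ) (t x y C'.2) * t x y C.2) := by
  rw [Finset.sum_mul_sum, Fintype.sum_prod_type]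
  refine Finset.sum_congr rfl fun a _ => Finset.sum_congr rfl fun x _ => ?_
  rw [Finset.sum_mul_sum, Fintype.sum_prod_type]
  refine Finset.sum_congr rfl fun b _ => Finset.sum_congr rfl fun y _ => ?_
  simp only [kroneckerTensor, map_mul]
  ring

/-- First Gram matrix of the unit tensor `⟨n⟩` is the identity. [folklore] -/
theorem gram_unitTensor_fst (n : ℕ) (a a' : Fin n) :
    ∑ b, ∑ c, (starRingEnd ℂ) (unitTensor ℂ n a' b c) * unitTensor ℂ n a b c =
      if a = a' then 1 else 0 := by
  rw [Finset.sum_eq_single a, Finset.sum_eq_single a]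
  · by_cases h : a = a' <;> simp [unitTensor_apply, h, eq_comm]
  · intro c _ hc; simp [unitTensor_apply, Ne.symm hc]
  · simp
  · intro b _ hb; simp [unitTensor_apply, Ne.symm hb]
  · simp

/-- Second Gram matrix of `⟨n⟩`. [folklore] -/
theorem gram_unitTensor_snd (n : ℕ) (b b' : Fin n) :
    ∑ a, ∑ c, (starRingEnd ℂ) (unitTensor ℂ n a b' c) * unitTensor ℂ n a b c =
      if b = b' then 1 else 0 := by
  rw [Finset.sum_eq_single b, Finset.sum_eq_single b]
  · by_cases h : b = b' <;> simp [unitTensor_apply, h]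
  · intro c _ hc; simp [unitTensor_apply, Ne.symm hc]
  · simp
  · intro a _ ha; simp [unitTensor_apply, ha]
  · simp

/-- Third Gram matrix of `⟨n⟩`. [folklore] -/
theorem gram_unitTensor_thd (n : ℕ) (c c' : Fin n) :
    ∑ a, ∑ b, (starRingEnd ℂ) (unitTensor ℂ n a b c') * unitTensor ℂ n a b c =
      if c = c' then 1 else 0 := by
  rw [Finset.sum_eq_single c, Finset.sum_eq_single c]
  · by_cases h : c = c' <;> simp [unitTensor_apply, h]
  · intro b _ hb; simp [unitTensor_apply, hb]
  · simp
  · intro a _ ha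
    refine Finset.sum_eq_zero fun b _ => ?_
    have hc : unitTensor ℂ n a b c = 0 := by
      rw [unitTensor_apply, if_neg]
      rintro ⟨rfl, rfl⟩
      exact ha rfl
    rw [hc, mul_zero]
  · simp

/-- Scalar Gram matrices multiply: `⟨n⟩ ⊠ t` has first Gram matrix `cst · 1` if `t` does. [folklore] -/
theorem gram_unitKronecker_fst (n : ℕ) (t : τ → τ → τ → ℂ) {cst : ℂ}
    (hG : ∀ x x' : τ, ∑ y, ∑ z, (starRingEnd ℂ) (t x' y z) * t x y z = if x = x' then cst else 0)
    (A A' : Fin n × τ) :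
    ∑ B, ∑ C, (starRingEnd ℂ) (kroneckerTensor (unitTensor ℂ n) t A' B C) *
        kroneckerTensor (unitTensor ℂ n) t A B C = if A = A' then cst else 0 := by
  obtain ⟨a, x⟩ := A
  obtain ⟨a', x'⟩ := A'
  rw [gram_kronecker_fst, gram_unitTensor_fst, hG]
  simp only [Prod.mk.injEq, ite_mul, one_mul, zero_mul, ite_and]

/-- Second leg. [folklore] -/
theorem gram_unitKronecker_snd (n : ℕ) (t : τ → τ → τ → ℂ) {cst : ℂ}
    (hG : ∀ y y' : τ, ∑ x, ∑ z, (starRingEnd ℂ) (t x y' z) * t x y z = if y = y' then cst else 0)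
    (B B' : Fin n × τ) :
    ∑ A, ∑ C, (starRingEnd ℂ) (kroneckerTensor (unitTensor ℂ n) t A B' C) *
        kroneckerTensor (unitTensor ℂ n) t A B C = if B = B' then cst else 0 := by
  obtain ⟨b, y⟩ := B
  obtain ⟨b', y'⟩ := B'
  rw [gram_kronecker_snd, gram_unitTensor_snd, hG]
  simp only [Prod.mk.injEq, ite_mul, one_mul, zero_mul, ite_and]

/-- Third leg. [folklore] -/
theorem gram_unitKronecker_thd (n : ℕ) (t : τ → τ → τ → ℂ) {cst : ℂ}
    (hG : ∀ z z' : τ, ∑ x, ∑ y, (starRingEnd ℂ) (t x y z') * t x y z = if z = z' then cst else 0)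
    (C C' : Fin n × τ) :
    ∑ A, ∑ B, (starRingEnd ℂ) (kroneckerTensor (unitTensor ℂ n) t A B C') *
        kroneckerTensor (unitTensor ℂ n) t A B C = if C = C' then cst else 0 := by
  obtain ⟨c, z⟩ := C
  obtain ⟨c', z'⟩ := C'
  rw [gram_kronecker_thd, gram_unitTensor_thd, hG]
  simp only [Prod.mk.injEq, ite_mul, one_mul, zero_mul, ite_and]

omit [DecidableEq τ] in
/-- `⟨n⟩ ⊠ t` is `1`-concise if `t` is. [folklore] -/
theorem concise_unitKronecker_fst (n : ℕ) {t : τ → τ → τ → ℂ}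
    (h : ∀ v : τ → ℂ, (∀ y z, ∑ x, v x * t x y z = 0) → v = 0) (V : Fin n × τ → ℂ)
    (hV : ∀ B C, ∑ A, V A * kroneckerTensor (unitTensor ℂ n) t A B C = 0) : V = 0 := by
  funext ⟨k, x⟩
  have hk : (fun x => V (k, x)) = 0 := by
    refine h _ fun y z => ?_
    have h0 := hV (k, y) (k, z)
    rw [Fintype.sum_prod_type, Finset.sum_eq_single k] at h0
    · simpa [kroneckerTensor, unitTensor_apply] using h0
    · intro l _ hl; simp [kroneckerTensor, unitTensor_apply, hl]
    · simp
  exact congr_fun hk x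

omit [DecidableEq τ] in
/-- `⟨n⟩ ⊠ t` is `2`-concise if `t` is. [folklore] -/
theorem concise_unitKronecker_snd (n : ℕ) {t : τ → τ → τ → ℂ}
    (h : ∀ v : τ → ℂ, (∀ x z, ∑ y, v y * t x y z = 0) → v = 0) (V : Fin n × τ → ℂ)
    (hV : ∀ A C, ∑ B, V B * kroneckerTensor (unitTensor ℂ n) t A B C = 0) : V = 0 := by
  funext ⟨k, y⟩
  have hk : (fun y => V (k, y)) = 0 := by
    refine h _ fun x z => ?_
    have h0 := hV (k, x) (k, z)
    rw [Fintype.sum_prod_type, Finset.sum_eq_single k] at h0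
    · simpa [kroneckerTensor, unitTensor_apply] using h0
    · intro l _ hl; simp [kroneckerTensor, unitTensor_apply, Ne.symm hl]
    · simp
  exact congr_fun hk y

omit [DecidableEq τ] in
/-- `⟨n⟩ ⊠ t` is `3`-concise if `t` is. [folklore] -/
theorem concise_unitKronecker_thd (n : ℕ) {t : τ → τ → τ → ℂ}
    (h : ∀ v : τ → ℂ, (∀ x y, ∑ z, v z * t x y z = 0) → v = 0) (V : Fin n × τ → ℂ)
    (hV : ∀ A B, ∑ C, V C * kroneckerTensor (unitTensor ℂ n) t A B C = 0) : V = 0 := by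
  funext ⟨k, z⟩
  have hk : (fun z => V (k, z)) = 0 := by
    refine h _ fun x y => ?_
    have h0 := hV (k, x) (k, y)
    rw [Fintype.sum_prod_type, Finset.sum_eq_single k] at h0
    · simpa [kroneckerTensor, unitTensor_apply] using h0
    · intro l _ hl; simp [kroneckerTensor, unitTensor_apply, Ne.symm hl]
    · simp
  exact congr_fun hk z

/-- **`⟨n⟩ ⊠ t` is polystable** whenever `t` is critical (scalar Gram matrices) and concise.
[cite: KempfNess1979, Thm. 0.2; BurgisserIkenmeyer2017, §4.2] -/
theorem isPolystableTensor_unitKronecker (n : ℕ) (t : τ → τ → τ → ℂ) {cst : ℂ}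
    (hG1 : ∀ x x' : τ, ∑ y, ∑ z, (starRingEnd ℂ) (t x' y z) * t x y z = if x = x' then cst else 0)
    (hG2 : ∀ y y' : τ, ∑ x, ∑ z, (starRingEnd ℂ) (t x y' z) * t x y z = if y = y' then cst else 0)
    (hG3 : ∀ z z' : τ, ∑ x, ∑ y, (starRingEnd ℂ) (t x y z') * t x y z = if z = z' then cst else 0)
    (h1 : ∀ v : τ → ℂ, (∀ y z, ∑ x, v x * t x y z = 0) → v = 0)
    (h2 : ∀ v : τ → ℂ, (∀ x z, ∑ y, v y * t x y z = 0) → v = 0)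
    (h3 : ∀ v : τ → ℂ, (∀ x y, ∑ z, v z * t x y z = 0) → v = 0) :
    IsPolystableTensor (kroneckerTensor (unitTensor ℂ n) t) :=
  isPolystableTensor_of_gram _ (gram_unitKronecker_fst n t hG1) (gram_unitKronecker_snd n t hG2)
    (gram_unitKronecker_thd n t hG3) (concise_unitKronecker_fst n h1) (concise_unitKronecker_snd n h2)
    (concise_unitKronecker_thd n h3)

end Kronecker

/-! ## §3  The two rung families are polystable -/

section Instances

/-- `⟨n⟩ ⊠ cw₂^{⊠N}` is polystable. [cite: KempfNess1979, Thm. 0.2; BurgisserIkenmeyer2017, §4.2] -/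
theorem isPolystableTensor_unitKronecker_cwTwoPow (n N : ℕ) :
    IsPolystableTensor (kroneckerTensor (unitTensor ℂ n) (kroneckerPow (cwTensor ℂ 2) N)) :=
  isPolystableTensor_unitKronecker n _ (gram_cwTwoPow_fst N) (gram_cwTwoPow_snd N)
    (gram_cwTwoPow_thd N) (concise_cwTwoPow_fst N) (concise_cwTwoPow_snd N) (concise_cwTwoPow_thd N)

/-- `⟨n⟩ ⊠ ⟨m,m,m⟩ = ⊕ⁿ ⟨m,m,m⟩` is polystable. [cite: BurgisserIkenmeyer2017, Cor. 4.9] -/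
theorem isPolystableTensor_unitKronecker_matMul (n m : ℕ) :
    IsPolystableTensor (kroneckerTensor (unitTensor ℂ n) (matMulTensor ℂ m m m)) :=
  isPolystableTensor_unitKronecker n _ (gram_matMulTensor_fst m) (gram_matMulTensor_snd m)
    (gram_matMulTensor_thd m) (concise_matMulTensor_fst m) (concise_matMulTensor_snd m)
    (concise_matMulTensor_thd m)

end Instances

/-! ## §4  Rigidity of the rungs at level one, and its spectral shadow -/

section Rigidity

/-- Restriction FROM a relabelled source is restriction from the source. [folklore] -/
theorem tensorRestrictsTo_of_relabel_source {ι ι' : Type} [Fintype ι] [Fintype ι']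
    {κ₁ κ₂ κ₃ : Type} (e : ι' ≃ ι) {t : ι → ι → ι → ℂ} {s : κ₁ → κ₂ → κ₃ → ℂ}
    (h : TensorRestrictsTo (fun a b c => t (e a) (e b) (e c)) s) : TensorRestrictsTo t s := by
  obtain ⟨A, B, C, h⟩ := h
  refine ⟨fun x a => A x (e.symm a), fun y b => B y (e.symm b), fun z c => C z (e.symm c),
    fun x y z => ?_⟩
  rw [h x y z]
  rw [← e.sum_comp]
  refine Finset.sum_congr rfl fun a _ => ?_
  rw [← e.sum_comp]
  refine Finset.sum_congr rfl fun b _ => ?_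
  rw [← e.sum_comp]
  refine Finset.sum_congr rfl fun c _ => ?_
  simp only [Equiv.symm_apply_apply]

/-- A relabelled `⟨n'⟩ ⊠ ⟨m,m,m⟩` (`n', m ≥ 1`) is non-zero. [folklore] -/
theorem relabel_unitKronecker_matMul_ne_zero {ι' : Type} {n' m : ℕ} (hn' : 0 < n') (hm : 0 < m)
    (e : ι' ≃ (Fin n' × (Fin m × Fin m))) :
    (fun a b c => kroneckerTensor (unitTensor ℂ n') (matMulTensor ℂ m m m) (e a) (e b) (e c)) ≠ 0 := by
  intro h
  have h0 := congr_fun (congr_fun (congr_fun h (e.symm (⟨0, hn'⟩, (⟨0, hm⟩, ⟨0, hm⟩))))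
    (e.symm (⟨0, hn'⟩, (⟨0, hm⟩, ⟨0, hm⟩)))) (e.symm (⟨0, hn'⟩, (⟨0, hm⟩, ⟨0, hm⟩)))
  simp [kroneckerTensor, matMulTensor] at h0

/-- **Rigidity of every rung at level one.**  For any bijection `e` of the formats, a degeneration
`⟨n⟩ ⊠ cw₂^{⊠N} ⊵ e^*(⟨n'⟩ ⊠ ⟨m,m,m⟩)` in the orbit-closure sense (`n', m ≥ 1`) is a TWO-SIDED
restriction (both tensors are polystable; `exists_smul_sl3_eq_of_degeneratesTo` even gives an
isomorphism up to a scalar). [cite: KempfNess1979, Thm. 0.2; BurgisserIkenmeyer2017, §4.2] -/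
theorem unitKronecker_restricts_both_of_degeneratesTo {n N n' m : ℕ} (hn' : 0 < n') (hm : 0 < m)
    (e : (Fin n × (Fin N → Fin 3)) ≃ (Fin n' × (Fin m × Fin m)))
    (hdeg : TensorDegeneratesTo (kroneckerTensor (unitTensor ℂ n) (kroneckerPow (cwTensor ℂ 2) N))
      (fun a b c => kroneckerTensor (unitTensor ℂ n') (matMulTensor ℂ m m m) (e a) (e b) (e c))) :
    TensorRestrictsTo (kroneckerTensor (unitTensor ℂ n) (kroneckerPow (cwTensor ℂ 2) N))
        (kroneckerTensor (unitTensor ℂ n') (matMulTensor ℂ m m m)) ∧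
      TensorRestrictsTo (kroneckerTensor (unitTensor ℂ n') (matMulTensor ℂ m m m))
        (kroneckerTensor (unitTensor ℂ n) (kroneckerPow (cwTensor ℂ 2) N)) := by
  haveI : Nonempty (Fin n × (Fin N → Fin 3)) := ⟨e.symm (⟨0, hn'⟩, (⟨0, hm⟩, ⟨0, hm⟩))⟩
  have hP₀ := isPolystableTensor_unitKronecker_cwTwoPow n N
  have hP₁ := isPolystableTensor_relabel e (isPolystableTensor_unitKronecker_matMul n' m)
  obtain ⟨h₁, h₂⟩ := restrictsTo_and_of_degeneratesTo hdeg hP₀ hP₁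
    (relabel_unitKronecker_matMul_ne_zero hn' hm e)
  exact ⟨tensorRestrictsTo_of_relabel e h₁, tensorRestrictsTo_of_relabel_source e h₂⟩

/-- **Spectral shadow of a two-sided restriction**: every universal spectral point lies ON the rung
line, `n' · F⟨m,m,m⟩ = n · F(cw₂)^N`. [cite: Strassen1988, Thm. 3.8] -/
theorem spectral_eq_of_restricts_both {n N n' m : ℕ}
    (h₁ : TensorRestrictsTo (kroneckerTensor (unitTensor ℂ n) (kroneckerPow (cwTensor ℂ 2) N))
      (kroneckerTensor (unitTensor ℂ n') (matMulTensor ℂ m m m)))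
    (h₂ : TensorRestrictsTo (kroneckerTensor (unitTensor ℂ n') (matMulTensor ℂ m m m))
      (kroneckerTensor (unitTensor ℂ n) (kroneckerPow (cwTensor ℂ 2) N)))
    (F : SpectralMap ℂ) (hF : IsUniversalSpectralPoint ℂ F) :
    (n' : ℝ) * F (matMulTensor ℂ m m m) = n * F (cwTensor ℂ 2) ^ N := by
  have e₁ := hF.mono _ _ h₁
  have e₂ := hF.mono _ _ h₂
  rw [hF.map_kronecker, hF.map_kronecker, hF.map_unitTensor, hF.map_unitTensor,
    hF.map_kroneckerPow] at e₁ e₂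
  exact le_antisymm e₁ e₂

/-- **The first open rung `1/2` at level one** (`⟨4⟩ ⊠ cw₂^{⊠2}` vs `⟨9⟩ ⊠ ⟨2,2,2⟩`, cubic format `36`):
a level-one degeneration, for any identification of the formats, forces `9 · F⟨2,2,2⟩ = 4 · F(cw₂)²`
at EVERY universal spectral point (and an isomorphism of the two tensors up to a scalar, which the
slice-rank profiles exclude — memo NODE-g32 §3). [cite: KempfNess1979, Thm. 0.2; Strassen1988, Thm. 3.8] -/
theorem rungHalf_levelOne (e : (Fin 4 × (Fin 2 → Fin 3)) ≃ (Fin 9 × (Fin 2 × Fin 2)))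
    (hdeg : TensorDegeneratesTo (kroneckerTensor (unitTensor ℂ 4) (kroneckerPow (cwTensor ℂ 2) 2))
      (fun a b c => kroneckerTensor (unitTensor ℂ 9) (matMulTensor ℂ 2 2 2) (e a) (e b) (e c)))
    (F : SpectralMap ℂ) (hF : IsUniversalSpectralPoint ℂ F) :
    (9 : ℝ) * F (matMulTensor ℂ 2 2 2) = 4 * F (cwTensor ℂ 2) ^ 2 := by
  obtain ⟨h₁, h₂⟩ := unitKronecker_restricts_both_of_degeneratesTo (by norm_num) (by norm_num) e hdeg
  have := spectral_eq_of_restricts_both h₁ h₂ F hF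
  push_cast at this
  exact this

/-- The same for the isomorphism clause: a level-one degeneration of rung `1/2` makes
`⟨9⟩ ⊠ ⟨2,2,2⟩` (relabelled) a non-zero scalar multiple of an `SL³`-translate of `⟨4⟩ ⊠ cw₂^{⊠2}`.
[cite: KempfNess1979, Thm. 0.2] -/
theorem rungHalf_levelOne_iso (e : (Fin 4 × (Fin 2 → Fin 3)) ≃ (Fin 9 × (Fin 2 × Fin 2)))
    (hdeg : TensorDegeneratesTo (kroneckerTensor (unitTensor ℂ 4) (kroneckerPow (cwTensor ℂ 2) 2))
      (fun a b c => kroneckerTensor (unitTensor ℂ 9) (matMulTensor ℂ 2 2 2) (e a) (e b) (e c))) :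
    ∃ (c : ℂ) (s : Matrix.SpecialLinearGroup (Fin 4 × (Fin 2 → Fin 3)) ℂ ×
        Matrix.SpecialLinearGroup (Fin 4 × (Fin 2 → Fin 3)) ℂ ×
        Matrix.SpecialLinearGroup (Fin 4 × (Fin 2 → Fin 3)) ℂ), c ≠ 0 ∧
      (fun a b c => kroneckerTensor (unitTensor ℂ 9) (matMulTensor ℂ 2 2 2) (e a) (e b) (e c)) =
        c • actTensor (s.1 : Matrix _ _ ℂ) (s.2.1 : Matrix _ _ ℂ) (s.2.2 : Matrix _ _ ℂ)
          (kroneckerTensor (unitTensor ℂ 4) (kroneckerPow (cwTensor ℂ 2) 2)) := by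
  haveI : Nonempty (Fin 4 × (Fin 2 → Fin 3)) := ⟨(0, fun _ => 0)⟩
  exact exists_smul_sl3_eq_of_degeneratesTo hdeg (isPolystableTensor_unitKronecker_cwTwoPow 4 2)
    (isPolystableTensor_relabel e (isPolystableTensor_unitKronecker_matMul 9 2))
    (relabel_unitKronecker_matMul_ne_zero (by norm_num) (by norm_num) e)

end Rigidity

end Summit.MatrixMultiplication.MatrixMultiplication.Theorems.OutsiderSandwichUnitKroneckerRigidity

end
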